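import Summits.ABC.StewartYu.PadicTwoSeries
import Summits.ABC.StewartYu.DescentLevelsThirdQ
import Literature.NumberTheory.Transcendental.PadicCW77KStep
import HarnessLib

/-!
# Cell abc-stewartyu, W80Two (vi): the `2`-adic extrapolation step (k-step) of the triadic descent

`Summits/ABC/StewartYu/PadicTwoKStep.lean` — cell `abc-stewartyu` (HOME
`run/shared/lean/pub/abc-stewartyu/`, seat p2; route `PadicPrimesW80TwoThirds`, crux `W80Two`
stmt-ABC-19486), sequel to lit's `PadicTwoSeries.lean` and to `DescentLevelsThirdQ.lean`.
Theorems and one definition (the node enumerator); no named fact.  The `p = 2` twin of p2's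
`PadicTwistKStep.lean` (odd `p`, odd nodes `2i+1`, radius `√p`):

* `Φ_natCast3` — at a natural number `s`, `φ_{J,τ}(s)` is the signed rational core `coreSum3` of
  the triadic level structure (lit's `Φ_natCast` read through `SetupQ.qΔ3 := DwQ (3^{J₀−J}) …`);
* `norm_Dw₃_le_sharp` — `‖Dw₃(z)‖₂ ≤ 2^{h·Lb}` on the unit disc (the coefficients lie in
  `wDen⁻¹ ℤ`, `‖wDen⁻¹‖₂ ≤ 2^{r + l h}`);
* `node3 i = 3⌊i/2⌋ + 1 + (i mod 2)` — the increasing enumeration `1, 2, 4, 5, 7, 8, …` of the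
  naturals prime to `3`; `i < 2M ↔ node3 i < 3M`;
* **`norm_Φ_le_of_zeros3`** — the `2`-adic extrapolation bound: if `φ_{J,τ''}` vanishes at every
  `s < N` with `3 ∤ s` (`|τ''| < Tlo`) and `‖Λ₀‖₂ ≤ 8⁻¹`, then for `‖z‖₂ ≤ 1` and `|τ| + t ≤ Tlo`,
  `‖φ_{J,τ}(z)‖₂ ≤ max (2^{hLb} ‖Λ₀‖₂ 2ᵗ 2^{condExp 2 N t}) (8^{hLb} / 4^{2⌊N/3⌋·t})` (and the same
  for `f_{J,τ}`): the small-jets Schwarz lemma (`PadicNewton.norm_tsum_le_max_of_small_jets_levels`,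
  radius `4`, lit's weighted bound `8^{hLb}`) at the `2⌊N/3⌋` nodes `node3 i < 3⌊N/3⌋`, each of
  multiplicity `t`, with the `2`-ADIC conditioning: two nodes are within `2^{−j}` iff they agree
  mod `2ʲ`, and `#{s < N : s ≡ c (mod 2ʲ)} ≤ N/2ʲ + 1`, so the level product is at most
  `2^{condExp 2 N t}` (`PadicCW77.condExp` at the RANGE `N`, not at the number of nodes — at `p = 2`
  the odd-prime trick `p ∤ 2` of `PadicTwistKStep` is gone);
* **`padic_kstep3`** — the k-step: vanishing of `coreSum3` at `{s < N : 3 ∤ s}` (`|τ| < Tlo`),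
  `‖Λ₀‖₂ ≤ 8⁻¹`, denominators/sizes of `coreSum3_{J,τ}(s₁)` for `s₁ < N'`, `3 ∤ s₁`, `|τ| + t ≤ Tlo`,
  and the numerical inequality `max (…) (…) < 1/(Dmax · Mmax)` give `coreSum3_{J,τ}(s₁) = 0` there
  (product formula, `PadicCW77.Rat.eq_zero_of_padicNorm_lt`).

## References
* [Yu1989] K. Yu, *Linear forms in p-adic logarithms*, Acta Arith. 53 (1989), §3 Lemma 3.3.
* [Yu1990] K. Yu, *Linear forms in p-adic logarithms II*, Compositio Math. 74 (1990), Lemma 1.2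
  (the Schwarz lemma), §3 (the case p = 2).
* [Waldschmidt1980] M. Waldschmidt, Acta Arith. 37 (1980), Lemma 3.5 (the archimedean k-step).
-/

noncomputable section

open NormedSpace Finset IsUltrametricDist Polynomial Metric Filter
open Literature.NumberTheory.Transcendental
open Literature.NumberTheory.Transcendental.Baker1975.Ch3 (wDen)
open Literature.NumberTheory.Transcendental.PadicCW77 (nodeSeq length_nodeSeq mem_nodeSeq count_nodeSeq
  countP_nodeSeq card_filter_range_mod_le condExp)
open scoped Nat Topology

namespace Summit.ABC.StewartYu

open Literature.NumberTheory.Transcendental.CW77.Setup (Idx Tau tauNorm)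

namespace TwoSetup

variable (S : TwoSetup) {h Lb : ℕ}

/-! ### The values at the integers are the rational cores `coreSum3` -/

/-- **`φ_{J,τ}(s) = coreSum3_{J,τ}(s)`** at a natural number `s` (lit's `Φ_natCast`; the triadic
`qΔ3` IS `DwQ (3^{J₀−J})` at `s`). [cite: CijsouwWaldschmidt1977, §4 (p. 188)] -/
theorem Φ_natCast3 (J₀ J : ℕ) (box : Finset (Idx S.d h Lb)) (pv : Idx S.d h Lb → ℤ) (τ : Tau S.d)
    (s : ℕ) :
    S.Φ J₀ J box pv τ (s : ℚ_[2]) = ((S.toQ.coreSum3 J₀ J box pv τ s : ℚ) : ℚ_[2]) := by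
  rw [S.Φ_natCast]
  rfl

/-- `‖φ_{J,τ}(s)‖₂ = ‖coreSum3_{J,τ}(s)‖₂`. [folklore] -/
theorem norm_Φ_natCast3 (J₀ J : ℕ) (box : Finset (Idx S.d h Lb)) (pv : Idx S.d h Lb → ℤ)
    (τ : Tau S.d) (s : ℕ) :
    ‖S.Φ J₀ J box pv τ (s : ℚ_[2])‖ = ‖((S.toQ.coreSum3 J₀ J box pv τ s : ℚ) : ℚ_[2])‖ := by
  rw [S.Φ_natCast3]

/-! ### Size of the `Δ`-factor on the unit disc -/

/-- **The SHARP size of the `Δ`-factor on the unit disc**: `‖Dw₃(z)‖₂ ≤ 2^{h·Lb}` for `‖z‖₂ ≤ 1`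
(ultrametric maximum over the coefficients, which have norm `≤ 2^{r + l h} ≤ 2^{h Lb}`).
[cite: CijsouwWaldschmidt1977, §4 Lemma 8 (p. 185)] -/
theorem norm_Dw₃_le_sharp (J₀ J : ℕ) (u : Idx S.d h Lb) (τ₀ : ℕ) {z : ℚ_[2]} (hz : ‖z‖ ≤ 1) :
    ‖S.Dw₃ J₀ J u τ₀ z‖ ≤ (2 : ℝ) ^ (h * Lb) := by
  have hN : (u.1.1 : ℕ) + (u.1.2 : ℕ) * h ≤ h * Lb := by
    have hr : (u.1.1 : ℕ) < h := u.1.1.isLt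
    have hl : (u.1.2 : ℕ) + 1 ≤ Lb := u.1.2.isLt
    have h1 : ((u.1.2 : ℕ) + 1) * h ≤ Lb * h := Nat.mul_le_mul_right _ hl
    rw [mul_comm h Lb]; nlinarith
  rw [S.Dw₃_eq_sum]
  refine norm_sum_le_of_forall_le_of_nonneg (by positivity) fun i _ => ?_
  rw [norm_mul, norm_pow]
  calc ‖S.wC₃ J₀ J u τ₀ i‖ * ‖z‖ ^ i ≤ ‖S.wC₃ J₀ J u τ₀ i‖ * 1 :=
        mul_le_mul_of_nonneg_left (pow_le_one₀ (norm_nonneg _) hz) (norm_nonneg _)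
    _ ≤ (2 : ℝ) ^ ((u.1.1 : ℕ) + (u.1.2 : ℕ) * h) := by
        rw [mul_one]; exact S.norm_coeff_iterate_derivative_wOf₃_le J₀ J u τ₀ i
    _ ≤ (2 : ℝ) ^ (h * Lb) := pow_le_pow_right₀ (by norm_num) hN

/-! ### The nodes: the naturals prime to `3` -/

/-- **The increasing enumeration of the naturals prime to `3`**: `node3 i = 3⌊i/2⌋ + 1 + (i mod 2)`
(`1, 2, 4, 5, 7, 8, …`). [folklore] -/
def node3 (i : ℕ) : ℕ := 3 * (i / 2) + 1 + i % 2

/-- `3 ∤ node3 i`. [folklore] -/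
theorem not_three_dvd_node3 (i : ℕ) : ¬ 3 ∣ node3 i := by unfold node3; omega

/-- `node3 i < 3M ↔ i < 2M`. [folklore] -/
theorem node3_lt_iff (i M : ℕ) : node3 i < 3 * M ↔ i < 2 * M := by unfold node3; omega

/-- `node3` is injective. [folklore] -/
theorem node3_injective : Function.Injective node3 := by
  intro i i' hii'; unfold node3 at hii'; omega

/-! ### The extrapolation bound on the unit disc -/

/-- **The `2`-adic extrapolation bound** (steps 1–2 of the k-step, usable at integer AND third
points): if `φ_{J,τ''}(s) = 0` for all `s < N` with `3 ∤ s` and `|τ''| < Tlo`, and `‖Λ₀‖₂ ≤ 8⁻¹`,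
then for every `z` of the unit disc and every `|τ| + t ≤ Tlo` (`t ≥ 1`),
`‖φ_{J,τ}(z)‖₂ ≤ max (2^{hLb} ‖Λ₀‖₂ 2ᵗ 2^{condExp 2 N t}) (8^{hLb} / 4^{2⌊N/3⌋·t})`: the Schwarz lemma
at radius `4` with lit's weighted bound `8^{hLb}`, at the `2⌊N/3⌋` nodes `node3 i < 3⌊N/3⌋ ≤ N` of
multiplicity `t`, jets bounded through Lemma 9 by `2^{hLb} · 2‖Λ₀‖₂ · 2^{t−1}`, and the `2`-adic
conditioning `∏ⱼ 2^{ballCount(2^{−j})} ≤ 2^{condExp 2 N t}` (nodes within `2^{−j}` agree mod `2ʲ`;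
`#{s < N : s ≡ c (mod 2ʲ)} ≤ N/2ʲ + 1`). The same bound holds for `f_{J,τ}(z)`.
[cite: Yu1990, Lemma 1.2 and §3] [cite: Waldschmidt1980, Lemma 3.5 (p. 270)] -/
theorem norm_Φ_le_of_zeros3 (J₀ J : ℕ) (box : Finset (Idx S.d h Lb)) (pv : Idx S.d h Lb → ℤ)
    {N Tlo t : ℕ} (ht : 1 ≤ t)
    (hzero : ∀ s, s < N → ¬ 3 ∣ s → ∀ τ'' : Tau S.d, tauNorm τ'' < Tlo →
      S.Φ J₀ J box pv τ'' (s : ℚ_[2]) = 0)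
    (hΛ : ‖S.Λ₀‖ ≤ (8 : ℝ)⁻¹) {z : ℚ_[2]} (hz : ‖z‖ ≤ 1)
    (τ : Tau S.d) (hτ : tauNorm τ + t ≤ Tlo) :
    ‖S.F J₀ J box pv τ z‖ ≤
        max ((2 : ℝ) ^ (h * Lb) * ‖S.Λ₀‖ * (2 : ℝ) ^ t * (2 : ℝ) ^ condExp 2 N t)
          ((8 : ℝ) ^ (h * Lb) / (4 : ℝ) ^ (2 * (N / 3) * t)) ∧
      ‖S.Φ J₀ J box pv τ z‖ ≤
        max ((2 : ℝ) ^ (h * Lb) * ‖S.Λ₀‖ * (2 : ℝ) ^ t * (2 : ℝ) ^ condExp 2 N t)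
          ((8 : ℝ) ^ (h * Lb) / (4 : ℝ) ^ (2 * (N / 3) * t)) := by
  classical
  have hTlo : 1 ≤ Tlo := by omega
  -- notation: `B` = the weighted coefficient bound (radius 4), `Q` = the sharp value bound on the
  -- unit disc, `Pt` = the size of `1/k!`, `k < t`
  set M : ℕ := N / 3 with hM
  set kpts : ℕ := 2 * M with hkpts
  set B : ℝ := (8 : ℝ) ^ (h * Lb) with hB
  set Q : ℝ := (2 : ℝ) ^ (h * Lb) with hQ
  set Pt : ℝ := (2 : ℝ) ^ (t - 1) with hPt
  set ρ : ℝ := 4 with hρdef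
  have hρ : 0 < ρ := by norm_num
  have h1ρ : (1 : ℝ) < ρ := by norm_num
  have hQ0 : 0 ≤ Q := by positivity
  have hΛ0 : 0 ≤ ‖S.Λ₀‖ := norm_nonneg _
  have h3M : 3 * M ≤ N := Nat.mul_div_le N 3
  -- (a) Lemma 9 on the unit disc (sharp form)
  have hz2 : ∀ z : ℚ_[2], ‖z‖ ≤ 1 → ‖z‖ ≤ 2 := fun z hz => hz.trans (by norm_num)
  have hFΦ : ∀ (τ' : Tau S.d) (z : ℚ_[2]), ‖z‖ ≤ 1 →
      ‖S.F J₀ J box pv τ' z - S.Φ J₀ J box pv τ' z‖ ≤ Q * (2 * ‖S.Λ₀‖) := fun τ' z hz =>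
    S.norm_F_sub_Φ_le J₀ J box pv τ' hΛ (hz2 z hz) hQ0 fun u _ => S.norm_Dw₃_le_sharp J₀ J u τ'.1 hz
  -- natural numbers lie in the unit disc
  have hnat : ∀ n : ℕ, ‖(n : ℚ_[2])‖ ≤ 1 := fun n => by
    exact_mod_cast Padic.norm_int_le_one (p := 2) (n : ℤ)
  -- (b) values at the nodes
  have hval : ∀ i < kpts, ∀ τ' : Tau S.d, tauNorm τ' ≤ Tlo - 1 →
      ‖S.F J₀ J box pv τ' ((node3 i : ℕ) : ℚ_[2])‖ ≤ Q * (2 * ‖S.Λ₀‖) := by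
    intro i hi τ' hτ'
    have hlt : node3 i < N := lt_of_lt_of_le ((node3_lt_iff i M).mpr hi) h3M
    have h0 : S.Φ J₀ J box pv τ' ((node3 i : ℕ) : ℚ_[2]) = 0 :=
      hzero _ hlt (not_three_dvd_node3 i) τ' (by omega)
    have := hFΦ τ' _ (hnat (node3 i))
    rwa [h0, sub_zero] at this
  -- the coefficient sequence and its weighted bound
  set b : ℕ → ℚ_[2] := S.coeffF J₀ J box pv τ with hb
  have hbB : PadicNewton.WtBdd ρ B b := S.wtBdd_coeffF J₀ J box pv τ
  -- the nodes
  set node : ℕ → ℚ_[2] := fun i => ((node3 i : ℕ) : ℚ_[2]) with hnode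
  set nodes : Finset ℚ_[2] := (range kpts).image node with hnodes
  have hmem : ∀ a ∈ nodes, ∃ i < kpts, a = node i := by
    intro a ha
    obtain ⟨i, hi, rfl⟩ := mem_image.mp ha
    exact ⟨i, mem_range.mp hi, rfl⟩
  have hnod : ∀ a ∈ nodes, ‖a‖ ≤ 1 := by
    intro a ha; obtain ⟨i, -, rfl⟩ := hmem a ha; exact hnat _
  -- differences of nodes are integers
  have hdiff : ∀ i i' : ℕ, node i - node i' = (((node3 i : ℤ) - node3 i' : ℤ) : ℚ_[2]) := by
    intro i i'; simp only [hnode]; push_cast; ring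
  -- the level structure: radii `R0 j = 2^{-j}`, levels `R j = R0 (min j Jm)`, `Jm = ⌊log₂ N⌋`
  set R0 : ℕ → ℝ := fun j => ((2 : ℝ)⁻¹) ^ j with hR0def
  have hR0pos : ∀ j, 0 < R0 j := fun j => by simp only [hR0def]; positivity
  have hR0anti : ∀ a b, a ≤ b → R0 b ≤ R0 a := fun a b hab => by
    simp only [hR0def]
    exact pow_le_pow_of_le_one (by positivity) (by norm_num) hab
  have hR0ratio : ∀ j, R0 j / R0 (j + 1) = 2 := by
    intro j; simp only [hR0def, pow_succ]; field_simp
  have hR0zpow : ∀ j : ℕ, R0 j = ((2 : ℕ) : ℝ) ^ (-(j : ℤ)) := fun j => by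
    simp only [hR0def, zpow_neg, zpow_natCast, inv_pow]; norm_num
  set Jm : ℕ := Nat.log 2 N with hJm
  set R : ℕ → ℝ := fun j => R0 (min j Jm) with hR
  have hR0 : R 0 = 1 := by simp [hR, hR0def]
  have hRpos : ∀ j, 0 < R j := fun j => hR0pos _
  have hRanti : ∀ j, R (j + 1) ≤ R j := fun j =>
    hR0anti _ _ (min_le_min (Nat.le_succ j) le_rfl)
  have hlev : ∀ a ∈ nodes, ∀ a' ∈ nodes, a ≠ a' → ∃ j < Jm + 1, ‖a - a'‖ = R j := by
    intro a ha a' ha' hne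
    obtain ⟨i, hi, rfl⟩ := hmem a ha
    obtain ⟨i', hi', rfl⟩ := hmem a' ha'
    set m : ℤ := (node3 i : ℤ) - node3 i' with hm
    have hm0 : m ≠ 0 := by
      intro h0; apply hne
      have : (node3 i : ℤ) = node3 i' := by omega
      have : node3 i = node3 i' := by exact_mod_cast this
      simp only [hnode, this]
    have hlt1 : node3 i < N := lt_of_lt_of_le ((node3_lt_iff i M).mpr hi) h3M
    have hlt2 : node3 i' < N := lt_of_lt_of_le ((node3_lt_iff i' M).mpr hi') h3M
    have hmabs : m.natAbs ≤ N := by omega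
    -- `v = ord₂ m ≤ Jm` since `2^v ≤ |m| ≤ N`
    have hdvd : 2 ^ padicValInt 2 m ∣ m.natAbs := by
      have h1 := Int.natAbs_dvd_natAbs.mpr (padicValInt_dvd (p := 2) m)
      simpa [Int.natAbs_pow] using h1
    have hvle : padicValInt 2 m ≤ Jm := by
      have h2 : 2 ^ padicValInt 2 m ≤ N :=
        (Nat.le_of_dvd (Int.natAbs_pos.mpr hm0) hdvd).trans hmabs
      exact Nat.le_log_of_pow_le (by norm_num) h2
    refine ⟨padicValInt 2 m, by omega, ?_⟩
    have hRv : R (padicValInt 2 m) = R0 (padicValInt 2 m) := by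
      simp only [hR, min_eq_left hvle]
    rw [hRv, hdiff, hR0zpow]
    have : ((m : ℚ) : ℚ_[2]) = (m : ℚ_[2]) := by push_cast; rfl
    rw [← this, Padic.norm_eq_zpow_neg_valuation (by exact_mod_cast hm0), Padic.valuation_ratCast,
      padicValRat.of_int]
  -- (c) the jets at the nodes (`‖1/k!‖₂ ≤ 2ᵏ ≤ 2^{t−1}`)
  set εj : ℝ := Q * (2 * ‖S.Λ₀‖) * Pt with hεj
  have hεj0 : 0 ≤ εj := by positivity
  have hjet : ∀ a ∈ nodes, ∀ k < t, ‖∑' n, PadicNewton.ddList (List.replicate k a) b n * a ^ n‖ ≤ εj := by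
    intro a ha k hkt
    obtain ⟨i, hi, rfl⟩ := hmem a ha
    have hj := S.norm_jet_F_le J₀ J box pv (hz2 _ (hnat (node3 i))) (Tlo - 1) (by positivity)
      (fun τ' hτ' => hval i hi τ' hτ') k τ (by omega)
    change ‖PadicNewton.jet _ b k‖ ≤ εj
    refine hj.trans ?_
    rw [hεj, mul_comm]
    refine mul_le_mul_of_nonneg_left ?_ (by positivity)
    exact (norm_inv_factorial_le_two_pow k).trans (pow_le_pow_right₀ (by norm_num) (by omega))
  -- the node sequence: each node `t` times
  have hcast_inj : Function.Injective node := by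
    intro i i' hii'
    have h' : node3 i = node3 i' := Nat.cast_injective (R := ℚ_[2]) hii'
    exact node3_injective h'
  set xs : List ℚ_[2] := nodeSeq node kpts t with hxs
  have hxs_mem : ∀ x ∈ xs, x ∈ nodes := by
    intro x hx
    obtain ⟨i, hi, rfl⟩ := mem_nodeSeq hx
    exact mem_image.mpr ⟨i, by simpa using hi, rfl⟩
  have hxs_len : xs.length = kpts * t := length_nodeSeq node kpts t
  have hxs_cnt : ∀ a ∈ nodes, xs.count a ≤ t := by
    intro a ha
    obtain ⟨i, hi, rfl⟩ := hmem a ha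
    rw [hxs, count_nodeSeq hcast_inj t kpts i, if_pos hi]
  -- (c') the conditioning: nodes within `2^{-j}` of `node i₀` agree with it mod `2^j`
  have hball : ∀ j : ℕ, 1 ≤ j → PadicNewton.ballCount nodes (R0 j) xs ≤ t * (N / 2 ^ j + 1) := by
    intro j hj
    unfold PadicNewton.ballCount
    refine Finset.sup_le fun a ha => ?_
    obtain ⟨i₀, hi₀, rfl⟩ := hmem a ha
    rw [hxs, countP_nodeSeq]
    have hsub : ∀ i ∈ range kpts, decide (‖node i - node i₀‖ ≤ R0 j) = true →
        node3 i % 2 ^ j = node3 i₀ % 2 ^ j := by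
      intro i _ hdec
      have hle : ‖node i - node i₀‖ ≤ R0 j := of_decide_eq_true hdec
      rw [hdiff, hR0zpow, Padic.norm_int_le_pow_iff_dvd] at hle
      have hmod : node3 i₀ ≡ node3 i [MOD 2 ^ j] := Nat.modEq_iff_dvd.mpr (by push_cast; exact hle)
      exact hmod.symm
    calc ∑ i ∈ range kpts, (if decide (‖node i - node i₀‖ ≤ R0 j) = true then t else 0)
        ≤ ∑ i ∈ range kpts, (if node3 i % 2 ^ j = node3 i₀ % 2 ^ j then t else 0) := by
          refine sum_le_sum fun i hi => ?_
          by_cases hd : decide (‖node i - node i₀‖ ≤ R0 j) = true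
          · rw [if_pos hd, if_pos (hsub i hi hd)]
          · rw [if_neg hd]; positivity
      _ = t * ((range kpts).filter fun i => node3 i % 2 ^ j = node3 i₀ % 2 ^ j).card := by
          rw [← Finset.sum_filter]; simp [mul_comm]
      _ ≤ t * ((range N).filter fun s => s % 2 ^ j = node3 i₀ % 2 ^ j).card := by
          refine Nat.mul_le_mul_left _ (Finset.card_le_card_of_injOn node3 (fun i hi => ?_) ?_)
          · rw [Finset.mem_coe, Finset.mem_filter, Finset.mem_range] at hi
            rw [Finset.mem_coe, Finset.mem_filter, Finset.mem_range]
            exact ⟨lt_of_lt_of_le ((node3_lt_iff i M).mpr hi.1) h3M, hi.2⟩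
          · exact fun i _ i' _ hii' => node3_injective hii'
      _ ≤ t * (N / 2 ^ j + 1) := Nat.mul_le_mul_left _ (card_filter_range_mod_le N _ _)
  have hcond : ∏ j ∈ range (Jm + 1), (R j / R (j + 1)) ^ PadicNewton.ballCount nodes (R (j + 1)) xs ≤
      (2 : ℝ) ^ condExp 2 N t := by
    -- the last level is free: `R Jm = R (Jm + 1)`
    rw [Finset.prod_range_succ]
    have hlast : R Jm / R (Jm + 1) = 1 := by
      simp only [hR, min_eq_left (le_refl Jm), min_eq_right (Nat.le_succ Jm), div_self (hR0pos _).ne']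
    rw [hlast, one_pow, mul_one]
    -- the lower levels: ratio `2`, exponent `ballCount (R0 (j+1))`
    have hin : ∀ j ∈ range Jm, (R j / R (j + 1)) ^ PadicNewton.ballCount nodes (R (j + 1)) xs =
        (2 : ℝ) ^ PadicNewton.ballCount nodes (R0 (j + 1)) xs := by
      intro j hj
      have hj' : j + 1 ≤ Jm := mem_range.mp hj
      simp only [hR, min_eq_left (Nat.le_of_succ_le hj'), min_eq_left hj', hR0ratio]
    rw [Finset.prod_congr rfl hin, Finset.prod_pow_eq_pow_sum]
    refine pow_le_pow_right₀ (by norm_num) ?_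
    have hJm : Jm ≤ Nat.log 2 (2 * N) := Nat.log_mono_right (by omega)
    unfold condExp
    calc ∑ j ∈ range Jm, PadicNewton.ballCount nodes (R0 (j + 1)) xs
        ≤ ∑ j ∈ range Jm, t * (N / 2 ^ (j + 1) + 1) := sum_le_sum fun j _ => hball (j + 1) (by omega)
      _ ≤ ∑ j ∈ range (Nat.log 2 (2 * N)), t * (N / 2 ^ (j + 1) + 1) :=
          sum_le_sum_of_subset_of_nonneg
            (fun j hj => mem_range.mpr (lt_of_lt_of_le (mem_range.mp hj) hJm)) fun _ _ _ => Nat.zero_le _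
  -- (d) the small-jets Schwarz lemma (level version) at `z`
  have hschwarz := PadicNewton.norm_tsum_le_max_of_small_jets_levels hρ h1ρ le_rfl hbB nodes hnod
    R hR0 hRpos hRanti (Jm + 1) hlev hεj0 hjet xs hxs_mem hxs_cnt hz
  have hzlt : ‖z‖ < 4 := lt_of_le_of_lt hz (by norm_num)
  have hF : ‖S.F J₀ J box pv τ z‖ ≤
      max (εj * ∏ j ∈ range (Jm + 1), (R j / R (j + 1)) ^ PadicNewton.ballCount nodes (R (j + 1)) xs)
        (B / ρ ^ xs.length * (xs.map fun x => ‖z - x‖).prod) := by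
    rw [S.F_eq_tsum J₀ J box pv τ hzlt]; exact hschwarz
  -- simplify the two terms
  have hprod : (xs.map fun x => ‖z - x‖).prod ≤ 1 := by
    have h := List.prod_map_le_prod_map₀ (s := xs) (fun x => ‖z - x‖)
      (fun _ => (1 : ℝ)) (fun x _ => norm_nonneg _) (fun x hx => by
        rw [sub_eq_add_neg]
        exact (norm_add_le_max _ _).trans (max_le hz (by rw [norm_neg]; exact hnod x (hxs_mem x hx))))
    simpa using h
  have hPt2 : (2 : ℝ) * Pt = (2 : ℝ) ^ t := by
    rw [hPt, ← pow_succ', Nat.sub_add_cancel ht]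
  have hterm1 : εj * ∏ j ∈ range (Jm + 1), (R j / R (j + 1)) ^ PadicNewton.ballCount nodes (R (j + 1)) xs ≤
      Q * ‖S.Λ₀‖ * (2 : ℝ) ^ t * (2 : ℝ) ^ condExp 2 N t := by
    have e : εj = Q * ‖S.Λ₀‖ * (2 : ℝ) ^ t := by rw [hεj, ← hPt2]; ring
    rw [e]
    exact mul_le_mul_of_nonneg_left hcond (by positivity)
  have hterm2 : B / ρ ^ xs.length * (xs.map fun x => ‖z - x‖).prod ≤ B / ρ ^ (kpts * t) := by
    rw [hxs_len]
    exact mul_le_of_le_one_right (by positivity) hprod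
  have hF' : ‖S.F J₀ J box pv τ z‖ ≤
      max (Q * ‖S.Λ₀‖ * (2 : ℝ) ^ t * (2 : ℝ) ^ condExp 2 N t) (B / ρ ^ (kpts * t)) :=
    hF.trans (max_le_max hterm1 hterm2)
  refine ⟨hF', ?_⟩
  -- `‖φ‖ ≤ max(‖f‖, ‖f − φ‖)`
  have e : S.Φ J₀ J box pv τ z = S.F J₀ J box pv τ z + -(S.F J₀ J box pv τ z - S.Φ J₀ J box pv τ z) := by
    ring
  rw [e]
  refine (norm_add_le_max _ _).trans (max_le hF' ?_)
  rw [norm_neg]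
  refine (hFΦ τ _ hz).trans (le_max_of_le_left ?_)
  have h1 : (2 : ℝ) ≤ (2 : ℝ) ^ t := by
    calc (2 : ℝ) = 2 ^ 1 := (pow_one _).symm
      _ ≤ 2 ^ t := pow_le_pow_right₀ (by norm_num) ht
  have h2 : (1 : ℝ) ≤ (2 : ℝ) ^ condExp 2 N t := one_le_pow₀ (by norm_num)
  calc Q * (2 * ‖S.Λ₀‖) = Q * ‖S.Λ₀‖ * 2 * 1 := by ring
    _ ≤ Q * ‖S.Λ₀‖ * (2 : ℝ) ^ t * (2 : ℝ) ^ condExp 2 N t := by gcongr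

/-! ### The k-step -/

/-- **The `2`-adic k-step of the triadic descent** (twin of `TwistSetup.padic_kstep`). Let the
rational cores `coreSum3_{J,τ''}(s)` vanish for `s < N`, `3 ∤ s`, `|τ''| < Tlo`, let `‖Λ₀‖₂ ≤ 8⁻¹`, and
let the caller supply, for every `|τ| + t ≤ Tlo` and every `s₁ < N'` with `3 ∤ s₁`, a denominator
`0 < D ≤ Dmax` with `D · coreSum3_{J,τ}(s₁) ∈ ℤ` and an archimedean bound `|coreSum3_{J,τ}(s₁)| ≤ Mmax`.
If `max (2^{hLb} ‖Λ₀‖₂ 2ᵗ 2^{condExp 2 N t}) (8^{hLb} / 4^{2⌊N/3⌋·t}) < 1/(Dmax · Mmax)` then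
`coreSum3_{J,τ}(s₁) = 0` for all such `s₁, τ` (product formula, `Rat.eq_zero_of_padicNorm_lt`).
[cite: Yu1989, §3 Lemma 3.3] [cite: Waldschmidt1980, Lemma 3.5 (p. 270)] -/
theorem padic_kstep3 (J₀ J : ℕ) (box : Finset (Idx S.d h Lb)) (pv : Idx S.d h Lb → ℤ)
    {N N' Tlo t : ℕ} (ht : 1 ≤ t)
    (hzero : ∀ s, s < N → ¬ 3 ∣ s → ∀ τ'' : Tau S.d, tauNorm τ'' < Tlo →
      S.toQ.coreSum3 J₀ J box pv τ'' s = 0)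
    (hΛ : ‖S.Λ₀‖ ≤ (8 : ℝ)⁻¹)
    {Dmax Mmax : ℝ}
    (hDM : ∀ τ : Tau S.d, tauNorm τ + t ≤ Tlo → ∀ s₁, s₁ < N' → ¬ 3 ∣ s₁ →
      ∃ D : ℕ, 0 < D ∧ (D : ℝ) ≤ Dmax ∧ (∃ m : ℤ, (D : ℚ) * S.toQ.coreSum3 J₀ J box pv τ s₁ = m) ∧
        |(S.toQ.coreSum3 J₀ J box pv τ s₁ : ℝ)| ≤ Mmax)
    (hfinal : max ((2 : ℝ) ^ (h * Lb) * ‖S.Λ₀‖ * (2 : ℝ) ^ t * (2 : ℝ) ^ condExp 2 N t)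
        ((8 : ℝ) ^ (h * Lb) / (4 : ℝ) ^ (2 * (N / 3) * t)) < 1 / (Dmax * Mmax)) :
    ∀ s₁, s₁ < N' → ¬ 3 ∣ s₁ → ∀ τ : Tau S.d, tauNorm τ + t ≤ Tlo →
      S.toQ.coreSum3 J₀ J box pv τ s₁ = 0 := by
  intro s₁ hs₁ h3 τ hτ
  have hz : ‖((s₁ : ℕ) : ℚ_[2])‖ ≤ 1 := by exact_mod_cast Padic.norm_int_le_one (p := 2) (s₁ : ℤ)
  -- the zeros of the rational cores are zeros of `Φ` at the nodes
  have hzeroΦ : ∀ s, s < N → ¬ 3 ∣ s → ∀ τ'' : Tau S.d, tauNorm τ'' < Tlo →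
      S.Φ J₀ J box pv τ'' (s : ℚ_[2]) = 0 := fun s hs h3s τ'' hτ'' => by
    rw [S.Φ_natCast3 J₀ J box pv τ'', hzero s hs h3s τ'' hτ'', Rat.cast_zero]
  have hcore := (S.norm_Φ_le_of_zeros3 J₀ J box pv ht hzeroΦ hΛ hz τ hτ).2
  rw [S.norm_Φ_natCast3 J₀ J box pv τ] at hcore
  obtain ⟨D, hD0, hDle, ⟨m, hm⟩, hM⟩ := hDM τ hτ s₁ hs₁ h3
  exact PadicCW77.Rat.eq_zero_of_padicNorm_lt (p := 2) hD0 hDle hm hM (lt_of_le_of_lt hcore hfinal)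

end TwoSetup

end Summit.ABC.StewartYu

end
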